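import Summits.ABC.StewartYu.PadicG3TwoArithBN
import Summits.ABC.StewartYu.PadicG3TwoSatSupplyW
import Summits.ABC.StewartYu.PadicG3TwoClose
import HarnessLib

/-!
# Crux `PadicCoreTwoRat` (stmt-ABC-20504) of route `YuMatveevShapeRat`, line `padic-two-sat-frame`: the registered stub
# `stub_countTwoN`/`stub_countTwoNW` — the Siegel count over `𝔑` (L1N) of the schedule of record `schedTwoN` at the padded record

Cell abc-stewartyu (HOME `run/shared/lean/pub/abc-stewartyu/`), WP-L.P(2) lead p3 (g10).  Theorems only.

`countTwoN_schedTwoN` — for every set-up, saturation datum and admissible ledger `P` (`N_q = 2^{m+2}`, `N ≤ (2/log 2)ⁿ·Ω`):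
`2·2^m·(2X+1)·binom(T03N 0 + d, d+1) ≤ (L03N + 1)·N·∏ⱼ (2·sN j)`, from p1's level-`0` Siegel count `PadicG3Par.siegel_count`
(`2(2X+1)·binom(M'+n, n)·K ≤ (L₀+1)·∏(2 side j + 1)` for `M' ≤ Mord 0 0`) at `M' = T03N 0 − 1` (`TwoSetup.T03N_zero_sub_one_le_Mord`, the
order reserve fits by `TwoSetup.reserve_le_L`), `2^m ≤ K`, `2 side j + 1 ≤ 2 sN j`, and the `Y₀`-degree over `N`:
`L₀ + 1 ≤ (L03N + 1)·N` (`L₀ = ⌈Y⌉`, `L03N = ⌈Y/N⌉`, `Y = 6X·C_bⁿ·Ω·K`).  Then **`stub_countTwoNW`** (registered twin of the skeleton's `stub_countTwoN`, stated by the tree `Prop`) = `TwoSetup.CountSupplyTwoNW` at the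
padded record `ParTwo.parTwo V Vmax (W + c_W d)` (`TwoSetup.parTwo_Nq_eq`, `ParTwo.parTwo_Ω`).

References: Yu. V. Nesterenko, LNM 1819 (2003), §3.5 Prop 3.9 (3.48); K. Yu, Acta Math. 211 (2013), (4.30).
-/

noncomputable section

-- `Summit.<Summit>.<Problem>` is the mandated summit-side namespace (CONVENTIONS §2); for the single-conjunct summit `ABC` the two
-- coincide, so the duplicate `ABC.ABC` is deliberate.
set_option linter.dupNamespace false

namespace Summit.ABC.ABC.Theorems

open Finset
open Summit.ABC.StewartYu Summit.ABC.StewartYu.TwoSetup Summit.ABC.StewartYu.PadicG3Par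

/-- **(L1N) for the schedule of record `schedTwoN`**: `2·2^m·(2X+1)·binom(T03N 0 + d, d+1) ≤ (L03N+1)·N·∏ⱼ(2·sN j)` for every
admissible ledger. [cite: Nesterenko2003, Prop 3.9 (3.48); shape only] -/
theorem countTwoN_schedTwoN (S : TwoSetup) (F : S.SatData) (P : PadicG3Par (S.d + 1)) (hNq : P.Nq = 2 ^ (P.m + 2))
    (hN : (F.N : ℝ) ≤ (2 / Real.log 2) ^ (S.d + 1) * P.Ω) :
    2 * 2 ^ P.m * ((2 * P.X + 1) * (S.T03N F P 0 + S.d).choose (S.d + 1)) ≤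
      (S.L03N F P + 1) * (F.N * ∏ j, (2 * S.sN P j)) := by
  have hres := S.reserve_le_L F P hNq (S.N_le_L_nat F P hN)
  have hM := S.T03N_zero_sub_one_le_Mord F P hres
  have h := P.siegel_count hM
  have e : S.T03N F P 0 - 1 + (S.d + 1) = S.T03N F P 0 + S.d := by have := S.one_le_T03N F P 0; omega
  rw [e] at h
  have hK : 2 ^ P.m ≤ P.K := by
    unfold PadicG3Par.K
    calc 2 ^ P.m ≤ P.p ^ P.m := Nat.pow_le_pow_left P.hp _
      _ ≤ P.p ^ P.m * P.K₀ := Nat.le_mul_of_pos_right _ (by have := P.hK₀; omega)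
  -- the boxes: `2 side j + 1 ≤ 2 sN j`
  have hbox : ∏ j, (2 * P.side j + 1) ≤ ∏ j, (2 * S.sN P j) :=
    Finset.prod_le_prod' fun j _ => by unfold TwoSetup.sN; omega
  -- the `Y₀`-degree over `N`: `L₀ + 1 ≤ (L03N + 1)·N`
  have hL : P.L₀ + 1 ≤ (S.L03N F P + 1) * F.N := by
    have hN1 := F.hN
    have hNr : (0 : ℝ) < F.N := by exact_mod_cast hN1
    set Y : ℝ := 6 * P.X * Cb ^ (S.d + 1) * P.Ω * P.K with hY
    have hY0 : 0 ≤ Y := by have := PadicG3Par.Cb_pos; have := P.Ω_pos; have := P.K_pos; positivity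
    have hceil : Y / F.N ≤ (S.L03N F P : ℝ) := by unfold TwoSetup.L03N; exact Nat.le_ceil _
    -- `(L03N + 1)·N ≥ Y + N ≥ Y + 1` as reals, hence `⌈Y⌉₊ ≤ (L03N+1)·N − 1`
    have hQ : Y + 1 ≤ (((S.L03N F P + 1) * F.N : ℕ) : ℝ) := by
      push_cast
      have hN1r : (1 : ℝ) ≤ F.N := by exact_mod_cast hN1
      have := mul_le_mul_of_nonneg_right hceil hNr.le
      rw [div_mul_cancel₀ _ hNr.ne'] at this
      nlinarith
    have hQ1 : 1 ≤ (S.L03N F P + 1) * F.N := Nat.one_le_iff_ne_zero.mpr (by positivity)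
    have hc : P.L₀ ≤ (S.L03N F P + 1) * F.N - 1 := by
      unfold PadicG3Par.L₀
      refine Nat.ceil_le.mpr ?_
      rw [Nat.cast_sub hQ1]; push_cast at hQ ⊢; linarith
    omega
  calc 2 * 2 ^ P.m * ((2 * P.X + 1) * (S.T03N F P 0 + S.d).choose (S.d + 1))
      = 2 * (2 * P.X + 1) * (S.T03N F P 0 + S.d).choose (S.d + 1) * 2 ^ P.m := by ring
    _ ≤ 2 * (2 * P.X + 1) * (S.T03N F P 0 + S.d).choose (S.d + 1) * P.K := Nat.mul_le_mul_left _ hK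
    _ ≤ (P.L₀ + 1) * ∏ j, (2 * P.side j + 1) := h
    _ ≤ ((S.L03N F P + 1) * F.N) * ∏ j, (2 * S.sN P j) := Nat.mul_le_mul hL hbox
    _ = (S.L03N F P + 1) * (F.N * ∏ j, (2 * S.sN P j)) := by ring

/-- **The registered stub `stub_countTwoNW` (= the skeleton's `stub_countTwoN`) of crux stmt-ABC-20504** (line `padic-two-sat-frame`): the count supply
`TwoSetup.CountSupplyTwoNW` — (L1N) of `schedTwoN` at the padded record `ParTwo.parTwo V Vmax (W + c_W d)` for every crux datum.
[cite: Nesterenko2003, Prop 3.9 (3.48), §3.5; shape only] -/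
theorem stub_countTwoNW : Summit.ABC.StewartYu.TwoSetup.CountSupplyTwoNW := by
  intro S F V Vmax W _hd hV1 hVmax hW1 hs4
  have hWt := one_le_padW hW1 S.d
  have hNq := TwoSetup.parTwo_Nq_eq V Vmax (W + (cW S.d : ℝ)) hV1 hVmax hWt
  have hΩ := ParTwo.parTwo_Ω V Vmax (W + (cW S.d : ℝ)) hV1 hVmax hWt
  refine countTwoN_schedTwoN S F _ hNq ?_
  rw [hΩ]; exact hs4

end Summit.ABC.ABC.Theorems

end
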